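/-
COR-CM (cell pub-hodgecm2, stage 2 of the Hodge ladder) — count-neutral KERNEL COMBINATORICS «field ⇄ intrinsic transfer of generating face families, generic»
(seat prover-pub-hodgecm2-b23-g41-0, binder prover b23, gen 41; claim QUARTIC-TRANSPORT, CLAIM-ADDENDUM #2, HOME/INBOX.md l.10220).
Theorems only; the generic §1 of `CorCM/FaceCyclicGeneration.lean` (`exists_faces_reading`, `span_translates_le_reads`), INT2-GEN's `hgen_of_weightRel_mem_span`,
seat b09's `FaceParity.gfaceSet_subset_of_hgen` and `FaceCoinvariant.pairRel_eq_span_pairSet` / `weightRel_corner_mem_hodgeSpan` are used BY NAME; no geometry,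
no named fact, nothing asserted; `Interfaces.lean` (C1), every E term, B01, `Transposition/*`, `PortJoin/*` untouched.
HONEST FRAMING: `HC_CM` is NOT proved, here or anywhere in the tree; nothing here is a period, a count of record or a headline.
T5: n/a-class (hypothesis binders: the intrinsic generation / floor statements and INT2-GEN's `hgen`); checker: self, 2026-08-23.
-/
import Summits.HodgeConjecture.CorCM.FaceCyclicGeneration
import Summits.HodgeConjecture.CorCM.FaceCoinvariantFloor
import HarnessLib

/-!
# Field ⇄ intrinsic transfer of generating face families (every Galois CM field)

Every field-form file of the face census (`CorCM/FaceCyclicGeneration`, `FaceComplementGeneration`, `FaceQuarticTwistGeneration`, …) turns an INTRINSIC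
generation theorem — a family `S ⊆ gfaceSet (GalT F) conjT` of abstract rank-four face relations whose base changes generate the integer Hodge lattice
`hodgeSpan` modulo the pairs — into INT2-GEN's generation binder `hgen(𝒮, σ₀)` for a set `𝒮` of rank-four FACES of `F`, and an intrinsic floor back into a
floor for face sets.  This file states the two directions once:

* `exists_faces_hgen_of_generate` (→): `S ⊆ gfaceSet` generating ⟹ `∃ 𝒮`, `|𝒮| ≤ |S|`, `hgen(𝒮, σ₀)` (faces of `F` reading the members of `S` at `σ₀`);
* `exists_generate_of_hgen` (←): `hgen(𝒮, σ₀)` ⟹ the `σ₀`-reads of `𝒮` — at most `|𝒮|` integer HODGE vectors — generate `hodgeSpan` modulo the pairs;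
* `isLeast_card_faces_hgen_of_intrinsic` (⇔): an intrinsic family of size `≤ μ` together with an intrinsic floor `μ ≤ |S₀|` valid for every generating family
  `S₀` of Hodge vectors gives `IsLeast {m | ∃ 𝒮, |𝒮| = m ∧ hgen(𝒮, σ₀)} μ`; `le_card_of_hgen_of_floor` is the floor half alone.

## References
* [Pohlmann1968] H. Pohlmann, Algebraic cycles on abelian varieties of complex multiplication type, Ann. of Math. 88 (1968), Thm 1.
-/

noncomputable section

open CategoryTheory NumberField NumberField.ComplexEmbedding
open Literature.AlgebraicGeometry Literature.AlgebraicGeometry.Motives Literature.AlgebraicGeometry.HodgeTheory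
open Literature.AlgebraicGeometry.ComplexMultiplication Literature.AlgebraicGeometry.Milne1999
open Literature.NumberTheory.Automorphic
open Literature.NumberTheory.Automorphic.PicardCM
open Summit.HodgeConjecture.CorCM.Domination

namespace Summit.HodgeConjecture.CorCM.FaceTransfer

open Summit.HodgeConjecture.CorCM.Prior.AllgGroup.RfwfAllgGroup
open Summit.HodgeConjecture.CorCM.Census.BlockParity
open Summit.HodgeConjecture.CorCM.Census.Coinvariant

variable {F : Type} [Field F] [NumberField F]

/-- **INTRINSIC ⟹ FIELD.**  A family `S` of abstract face relations of `(GalT F, conjT)` whose base changes generate `hodgeSpan` modulo the pairs is read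
at `σ₀` by at most `|S|` rank-four faces of `F`, which then satisfy INT2-GEN's `hgen(𝒮, σ₀)`. [folklore] -/
theorem exists_faces_hgen_of_generate [IsCMField F] [IsGalois ℚ F] (σ₀ : F →+* ℂ) (S : Finset (CMF (GalT F) conjT →₀ ℤ))
    (hS : (↑S : Set (CMF (GalT F) conjT →₀ ℤ)) ⊆ gfaceSet (GalT F) conjT conjT_mul_self)
    (hgenr : hodgeSpan (conjT : GalT F) conjT_mul_self ≤
      Submodule.span ℤ (pairSet (conjT : GalT F)) ⊔ Submodule.span ℤ (translates conjT S)) :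
    ∃ 𝒮 : Finset (Face F), 𝒮.card ≤ S.card ∧
      ∀ f : Face F, lefChar f.corner (fun _ => ({σ₀} : Finset (F →+* ℂ))) ∈ AddSubgroup.closure
        {a : Asym F | ∃ g ∈ (𝒮 : Set (Face F)), ∃ σ : F →+* ℂ, a = lefChar g.corner (fun _ => ({σ} : Finset (F →+* ℂ)))} := by
  obtain ⟨𝒮, h𝒮card, hread⟩ := FaceCyclic.exists_faces_reading σ₀ S hS
  have hle := FaceCyclic.span_translates_le_reads σ₀ S (𝒮 : Set (Face F))
    (fun s hs => by obtain ⟨g, hg, h⟩ := hread s hs; exact ⟨g, Finset.mem_coe.mpr hg, h⟩)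
  exact ⟨𝒮, h𝒮card, hgen_of_weightRel_mem_span (𝒮 : Set (Face F)) σ₀ fun f =>
    hle (hgenr (FaceCoinvariant.weightRel_corner_mem_hodgeSpan f σ₀))⟩

/-- **FIELD ⟹ INTRINSIC.**  If `hgen(𝒮, σ₀)` holds, the `σ₀`-reads of `𝒮` — at most `|𝒮|` integer Hodge vectors — generate `hodgeSpan` modulo the pairs with
their base changes. [folklore] -/
theorem exists_generate_of_hgen [IsCMField F] [IsGalois ℚ F] (𝒮 : Finset (Face F)) (σ₀ : F →+* ℂ)
    (hgen : ∀ f : Face F, lefChar f.corner (fun _ => ({σ₀} : Finset (F →+* ℂ))) ∈ AddSubgroup.closure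
      {a : Asym F | ∃ g ∈ (𝒮 : Set (Face F)), ∃ σ : F →+* ℂ, a = lefChar g.corner (fun _ => ({σ} : Finset (F →+* ℂ)))}) :
    ∃ S₀ : Finset (CMF (GalT F) conjT →₀ ℤ), S₀.card ≤ 𝒮.card ∧ (↑S₀ : Set (CMF (GalT F) conjT →₀ ℤ)) ⊆ hodgeSpan (conjT : GalT F) conjT_mul_self ∧
      hodgeSpan (conjT : GalT F) conjT_mul_self ≤ Submodule.span ℤ (pairSet (conjT : GalT F)) ⊔ Submodule.span ℤ (translates conjT S₀) := by
  classical
  refine ⟨𝒮.image fun g : Face F => weightRel g.corner (fun _ => ({σ₀} : Finset (F →+* ℂ))), Finset.card_image_le, ?_, ?_⟩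
  · intro y hy
    obtain ⟨g, -, rfl⟩ := Finset.mem_image.mp (Finset.mem_coe.mp hy)
    exact FaceCoinvariant.weightRel_corner_mem_hodgeSpan g σ₀
  · have hX := FaceParity.gfaceSet_subset_of_hgen 𝒮 σ₀ hgen
    rw [FaceCoinvariant.pairRel_eq_span_pairSet] at hX
    exact sup_le (Submodule.span_le.mpr hX) le_sup_left

/-- **Floor transfer**: an intrinsic floor `μ ≤ |S₀|`, valid for every family `S₀` of integer Hodge vectors generating `hodgeSpan` modulo the pairs, bounds every
face set with `hgen(𝒮, σ₀)`: `μ ≤ |𝒮|`. [folklore] -/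
theorem le_card_of_hgen_of_floor [IsCMField F] [IsGalois ℚ F] (μ : ℕ)
    (hfloor : ∀ S₀ : Finset (CMF (GalT F) conjT →₀ ℤ), (↑S₀ : Set (CMF (GalT F) conjT →₀ ℤ)) ⊆ hodgeSpan (conjT : GalT F) conjT_mul_self →
      hodgeSpan (conjT : GalT F) conjT_mul_self ≤ Submodule.span ℤ (pairSet (conjT : GalT F)) ⊔ Submodule.span ℤ (translates conjT S₀) →
      μ ≤ S₀.card)
    (𝒮 : Finset (Face F)) (σ₀ : F →+* ℂ)
    (hgen : ∀ f : Face F, lefChar f.corner (fun _ => ({σ₀} : Finset (F →+* ℂ))) ∈ AddSubgroup.closure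
      {a : Asym F | ∃ g ∈ (𝒮 : Set (Face F)), ∃ σ : F →+* ℂ, a = lefChar g.corner (fun _ => ({σ} : Finset (F →+* ℂ)))}) :
    μ ≤ 𝒮.card := by
  obtain ⟨S₀, hcard, hS₀, hS⟩ := exists_generate_of_hgen 𝒮 σ₀ hgen
  exact (hfloor S₀ hS₀ hS).trans hcard

/-- **`IsLeast` transfer**: an intrinsic face family of size `≤ μ` generating `hodgeSpan` modulo the pairs, plus an intrinsic floor `μ` for generating families of
Hodge vectors, give EXACTLY `μ` as the least size of a face set with `hgen(𝒮, σ₀)` — for every base embedding `σ₀`. [folklore] -/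
theorem isLeast_card_faces_hgen_of_intrinsic [IsCMField F] [IsGalois ℚ F] (μ : ℕ)
    (hex : ∃ S : Finset (CMF (GalT F) conjT →₀ ℤ), (↑S : Set (CMF (GalT F) conjT →₀ ℤ)) ⊆ gfaceSet (GalT F) conjT conjT_mul_self ∧ S.card ≤ μ ∧
      hodgeSpan (conjT : GalT F) conjT_mul_self ≤ Submodule.span ℤ (pairSet (conjT : GalT F)) ⊔ Submodule.span ℤ (translates conjT S))
    (hfloor : ∀ S₀ : Finset (CMF (GalT F) conjT →₀ ℤ), (↑S₀ : Set (CMF (GalT F) conjT →₀ ℤ)) ⊆ hodgeSpan (conjT : GalT F) conjT_mul_self →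
      hodgeSpan (conjT : GalT F) conjT_mul_self ≤ Submodule.span ℤ (pairSet (conjT : GalT F)) ⊔ Submodule.span ℤ (translates conjT S₀) →
      μ ≤ S₀.card)
    (σ₀ : F →+* ℂ) :
    IsLeast {m : ℕ | ∃ 𝒮 : Finset (Face F), 𝒮.card = m ∧
      ∀ f : Face F, lefChar f.corner (fun _ => ({σ₀} : Finset (F →+* ℂ))) ∈ AddSubgroup.closure
        {a : Asym F | ∃ g ∈ (𝒮 : Set (Face F)), ∃ σ : F →+* ℂ, a = lefChar g.corner (fun _ => ({σ} : Finset (F →+* ℂ)))}} μ := by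
  obtain ⟨S, hS, hcard, hgenr⟩ := hex
  obtain ⟨𝒮, h𝒮card, hgen⟩ := exists_faces_hgen_of_generate σ₀ S hS hgenr
  have hμ := le_card_of_hgen_of_floor μ hfloor 𝒮 σ₀ hgen
  refine ⟨⟨𝒮, by omega, hgen⟩, ?_⟩
  rintro m ⟨𝒮', rfl, hgen'⟩
  exact le_card_of_hgen_of_floor μ hfloor 𝒮' σ₀ hgen'

/-- **Existence transfer with the exact count**: under the same hypotheses a face set of size EXACTLY `μ` with `hgen(𝒮, σ₀)` exists. [folklore] -/
theorem exists_faces_hgen_card_eq_of_intrinsic [IsCMField F] [IsGalois ℚ F] (μ : ℕ)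
    (hex : ∃ S : Finset (CMF (GalT F) conjT →₀ ℤ), (↑S : Set (CMF (GalT F) conjT →₀ ℤ)) ⊆ gfaceSet (GalT F) conjT conjT_mul_self ∧ S.card ≤ μ ∧
      hodgeSpan (conjT : GalT F) conjT_mul_self ≤ Submodule.span ℤ (pairSet (conjT : GalT F)) ⊔ Submodule.span ℤ (translates conjT S))
    (hfloor : ∀ S₀ : Finset (CMF (GalT F) conjT →₀ ℤ), (↑S₀ : Set (CMF (GalT F) conjT →₀ ℤ)) ⊆ hodgeSpan (conjT : GalT F) conjT_mul_self →
      hodgeSpan (conjT : GalT F) conjT_mul_self ≤ Submodule.span ℤ (pairSet (conjT : GalT F)) ⊔ Submodule.span ℤ (translates conjT S₀) →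
      μ ≤ S₀.card)
    (σ₀ : F →+* ℂ) :
    ∃ 𝒮 : Finset (Face F), 𝒮.card = μ ∧
      ∀ f : Face F, lefChar f.corner (fun _ => ({σ₀} : Finset (F →+* ℂ))) ∈ AddSubgroup.closure
        {a : Asym F | ∃ g ∈ (𝒮 : Set (Face F)), ∃ σ : F →+* ℂ, a = lefChar g.corner (fun _ => ({σ} : Finset (F →+* ℂ)))} :=
  (isLeast_card_faces_hgen_of_intrinsic μ hex hfloor σ₀).1

end Summit.HodgeConjecture.CorCM.FaceTransfer

end
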